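import Summits.QuantumFields.YangMills.Theorems.BalabanUVNodesN21GappedTopPair13CoPHCount
import Summits.QuantumFields.YangMills.Theorems.BalabanUVNodesN21GappedTopCut13CoPHRecord

/-!
# N21 (NE7c) · THE GAPPED TOP CUT FOR BOTH INDICATOR FAMILIES AT THE `CoPH`-KEYED STAGE-13 RECORD: the pair-lettered terms are an EXTRACTION-GRADE expansion of
# the run's partition function at EVERY letter pair (E1 ∕ E2), and for the two runs OF RECORD of a comparison `K` (n20-d's `runA₁₃ ∕ runB₁₃ ∕ histA₁₃ ∕ histB₁₃`) on
# the live-selector line, ONE COMMON (3.2) DEPTH `i ≤ n₁` AND ONE COMMON (3.3) DEPTH `j ≤ n₂` whose TWO-COLLAR shells weigh at most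
# `4(2L^m)⁴(1∕(n₁+1) + 1∕(n₂+1)) ×` the runs' partition sums — rows: the live-selector pin, (H-ζ), the dial signs and the tops' letter signs ONLY ((M1)-FREE)

WIDTH SEAT `pub-ymgap-dag-n21-w7` (g2), node N21 = NE7c (NOT PRINTED; NOT proved at print's fixed thresholds); lane K3⁸ `SpineGivenEndpointR13SepCoPHV`
(stmt-QuantumFields-27366, `--supports … --as helper`; COUNT-NEUTRAL).  THEOREMS ONLY (0 `def`).  Imports this seat's `…N21GappedTopPair13CoPHCount` (§Q5
`exists_common_depths_topGap2Shell_le`) and the lane owner dag-n21-d's U4 `…N21GappedTopCut13CoPHRecord` (p621897; through it T3 `…SelectedTopCut13CoPHRecord`: E1∕E2 road,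
g9's `integrable_chi_mul_dressedSlots_of_ppSelLive`, (POS)-ζ `zetaOfRecord_nonneg`, dag-n19-d's `sum_classWeightOfDatum₉_datumOfRecord₁₃CoPH_eq_schemeZ_of_ppSelLive`).
The record-level twin of U4 for the (3.3) object half accepted from the lane owner (OFFER-2, cell bus 2026-08-28 10:02Z; lane owner ■ 10:49Z: «the (3.3) family =
n21-w7's `…GappedTopPair…` lineage»).

WHAT THIS FILE PROVES (theorems only; 0 `def`, 0 `sorry`).
* §R1 (NODE 00's generality) `integrable_topSlot2At`, `integrable_topPiece2`, ★ `isRT_topAssembled2` (for EVERY letter pair `(θ, δ′)` the assembled pair-lettered density is an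
  RT-image of the record's level-`k` density: def-T `isRT_tstepOfRecordAt` with `isStepUnity_wTop2At`), ★ `sum_topClassWeight2At_eq` (E1-step: `Σ_{s′} topClassWeight2^{θ,δ′}(s′) =
  Σ_s classWeight_k(s)` — re-lettering BOTH families of the top step expands the SAME partition function).
* §R2 (the record, rows `hsel` + (H-ζ)): `topGap2ShellAt_nonneg_of_liveSel`, `topGap2ShellAt_le_topClassWeight2At_of_provisos` (the `sh_nonneg ∕ sh_le` clauses);
  ★★ `sum_topClassWeight2At_runA_eq_schemeZ_of_liveSel` ∕ `…runB…` (E1∕E2 at every letter pair); ★★★ `exists_common_depths_topGap2Shell_le_of_liveSel` (§Q5 at the two runs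
  of record: common `i ≤ n₁`, `j ≤ n₂`, bounds relative to the level-`k` partition sums) and ★★★ `exists_common_depths_topGap2Shell_le_topClassWeight2_of_liveSel` (the same,
  RELATIVE TO THE PAIR-LETTERED TERMS THEMSELVES at the selected middle letters `(θ_{i+1}, δ′_{j+1})` — the `left ∕ right` fields of `T4IndicatorShell.ShellWeightBound` for a
  reading carrying the two-collar shells; with `Σ_K (1∕(n₁,K+1) + 1∕(n₂,K+1)) < ∞` summable).
Sequel (the keyed READING `crGap2₁₃VAt` carrying these carriers, U5∕U6 twins): `…N21GappedTopPairReading13CoPH{Defs,}`.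

HONEST FRAMING (binding).  Bookkeeping BY NAME; NO estimate of Bałaban's; only the top step's (3.2) AND (3.3) factor families are re-lettered (the residual `ζ` ∕ (3.5), the
ℝ-side, the selector and everything below the top step are print's ∕ the record's — LOCATED); the top 𝐑-step omitted as in T1; the keyed READING and the K3 skeleton's
`PinnedAtLive` admitting it are NOT typed here; the common-refinement comparison and the core sandwich are the CONSUMER's; NOT a bound at print's fixed thresholds ((M1) stands
there); no `Provisos₁₃CoPH` inhabitant claimed (K0⁷ open); NE7c NOT PRINTED ∕ NOT proved at print's thresholds; N21 NOT discharged; K3⁸ NOT claimed; counts UNMOVED (typed 28∕28 ·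
discharged 5∕27, A 5∕28); never a count claim.  No `instance`, no `notation`, no `def`.  One finite four-torus programme at fixed `ε` — NOT ℝ⁴, NOT OS, NOT a mass gap, NOT the
Clay problem.
-/

noncomputable section

open scoped BigOperators
open Finset MeasureTheory

namespace Summit.QuantumFields.YangMills.Theorems.N21GappedTopPair13CoPH

open Literature.MathematicalPhysics.QuantumFieldTheory.Balaban1983to89
open Literature.MathematicalPhysics.QuantumFieldTheory.Balaban1983to89.T4Continuum
open Literature.MathematicalPhysics.QuantumFieldTheory.Balaban1983to89.Node00
open YMDAG.UVSplit (runA₁₃ runB₁₃ histA₁₃ histB₁₃ histA₁₃_zero histB₁₃_zero)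
open Summit.QuantumFields.YangMills.Theorems.N21StepWeightsPositivity (zetaOfRecord_nonneg)
open Summit.QuantumFields.YangMills.BalabanUVNodes.N19MGFFormAtRecordMass (sum_classWeightOfDatum₉_datumOfRecord₁₃CoPH_eq_schemeZ_of_ppSelLive)
open Summit.QuantumFields.YangMills.BalabanUVNodes.N19MGFRoadLiveSelectorTower (dressedSlotsOfDatum₉_nonneg)
open Summit.QuantumFields.YangMills.BalabanUVNodes.N19MGFFormAtRecord (wOfRecord₉_nonneg)
open Summit.QuantumFields.YangMills.Theorems.N21ShellSplitOfRecord13CoPH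

/-! ## §R1 The pair-lettered terms re-sum to the level-`k` partition sum at EVERY letter pair (E1-step) -/

section E1

variable (F : T4Family) (N : ℕ) [NeZero N] (ϑ : Stage9Params F N) (D : FiniteEpsData F (SU N)) (g₀ : ℕ → ℝ) (os : List (ULoop F))
  (p : B12.RunParams) (g : ℕ → ℝ) (k : ℕ)

/-- the pair-lettered slot is integrable (`k < p.K`; def-T `integrable_tstepOfRecordAt`: (H-ζ), `Σ|ζ| ≤ 1`, F3's (e1) integrability at level `k`). [bookkeeping] -/
theorem integrable_topSlot2At (hk : k < p.K) (hζm : ZetaMeasurable F N ϑ.ζ) (hζ1 : IsZetaAbsLeOne F N ϑ.ν ϑ.τ9.M ϑ.ζ) (θ δ' t : ℝ)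
    (hint : ∀ s : SeqOfRecord F ϑ.ν ϑ.τ9.M g p.K k,
      Integrable (fun U => chiSeqOfRecord F N ϑ.ν ϑ.τ9.M g p.K k s U * dressedSlotsOfDatum₉ F N ϑ D g₀ os t p g k s U) (fieldMeasure (F.P p.K) k (SU N)))
    (s' : SeqOfRecord F ϑ.ν ϑ.τ9.M g p.K (k + 1)) :
    Integrable (topSlot2At F N ϑ D g₀ os p g k θ δ' t s') (fieldMeasure (F.P p.K) (k + 1) (SU N)) := by
  unfold topSlot2At
  refine integrable_tstepOfRecordAt F N ϑ.ν ϑ.τ9.M (topLetter ϑ.ν θ) hk (fun s'' => measurable_wTop2At F N ϑ p g k hζm θ δ' s'')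
    (fun s'' U V' => abs_wTop2At_le_one F N ϑ p g k hζ1 θ δ' s'' U V') (fun s => ?_) s'
  rw [chiSeqOfRecordAt_topLetter_of_lt F N ϑ p g k hk]
  exact hint s

/-- a pair-lettered piece `χ_{k+1}^{θ′}(s′)·topSlot2^{θ,δ′}(s′)` is integrable (bounded measurable front factor). [bookkeeping] -/
theorem integrable_topPiece2 (hk : k < p.K) (hζm : ZetaMeasurable F N ϑ.ζ) (hζ1 : IsZetaAbsLeOne F N ϑ.ν ϑ.τ9.M ϑ.ζ) (θ θ' δ' t : ℝ)
    (hint : ∀ s : SeqOfRecord F ϑ.ν ϑ.τ9.M g p.K k,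
      Integrable (fun U => chiSeqOfRecord F N ϑ.ν ϑ.τ9.M g p.K k s U * dressedSlotsOfDatum₉ F N ϑ D g₀ os t p g k s U) (fieldMeasure (F.P p.K) k (SU N)))
    (s' : SeqOfRecord F ϑ.ν ϑ.τ9.M g p.K (k + 1)) :
    Integrable (fun V => chiSeqOfRecordAt F N ϑ.ν ϑ.τ9.M g p.K (k + 1) θ' s' V * topSlot2At F N ϑ D g₀ os p g k θ δ' t s' V)
      (fieldMeasure (F.P p.K) (k + 1) (SU N)) :=
  (integrable_topSlot2At F N ϑ D g₀ os p g k hk hζm hζ1 θ δ' t hint s').bdd_mul (c := 1)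
    ((measurable_chiSeqOfRecordAt_of_localBg (localBgMeasurable F N ϑ.ν) ϑ.τ9.M g p.K (k + 1) θ' s').aestronglyMeasurable)
    (ae_of_all _ fun V => by rw [Real.norm_eq_abs]; exact abs_chiSeqOfRecordAt_le_one F N ϑ.ν ϑ.τ9.M g p.K (k + 1) θ' s' V)

/-- ★ **FOR EVERY LETTER PAIR THE ASSEMBLED PAIR-LETTERED DENSITY IS AN RT-IMAGE OF THE RECORD's LEVEL-`k` DENSITY** (`k + 1 = p.K`): def-T's `isRT_tstepOfRecordAt` at the letters
`(topLetter ν θ, topBLetter ϑ δ′)` with the unity `isStepUnity_wTop2At` (`Σζ = 1`); the level-`k` front factor is the record's.  Displayed: `Σζ = 1`, `Σ|ζ| ≤ 1`, (H-ζ), (e1) at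
level `k`. [bookkeeping] -/
theorem isRT_topAssembled2 (hk : k + 1 = p.K) (hζm : ZetaMeasurable F N ϑ.ζ) (hζ1 : IsZetaAbsLeOne F N ϑ.ν ϑ.τ9.M ϑ.ζ) (hζu : IsZetaUnity F N ϑ.ν ϑ.τ9.M ϑ.ζ)
    (θ δ' t : ℝ)
    (hint : ∀ s : SeqOfRecord F ϑ.ν ϑ.τ9.M g p.K k,
      Integrable (fun U => chiSeqOfRecord F N ϑ.ν ϑ.τ9.M g p.K k s U * dressedSlotsOfDatum₉ F N ϑ D g₀ os t p g k s U) (fieldMeasure (F.P p.K) k (SU N))) :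
    IsRT (avOfRecord F N p.K k).avg
      (fun U => ∑ s, chiSeqOfRecord F N ϑ.ν ϑ.τ9.M g p.K k s U * dressedSlotsOfDatum₉ F N ϑ D g₀ os t p g k s U)
      (fun V => ∑ s', chiSeqOfRecordAt F N ϑ.ν ϑ.τ9.M g p.K (k + 1) θ s' V * topSlot2At F N ϑ D g₀ os p g k θ δ' t s' V) := by
  have hk' : k < p.K := by omega
  have hlow := chiSeqOfRecordAt_topLetter_of_lt F N ϑ p g k hk' θ
  have htop : topLetter ϑ.ν θ p g (k + 1) = θ := by rw [hk]; exact topLetter_top ϑ.ν θ p g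
  have h := isRT_tstepOfRecordAt F N ϑ.ν ϑ.τ9.M (topLetter ϑ.ν θ) (wTop2At F N ϑ θ δ') p g k hk'
    (dressedSlotsOfDatum₉ F N ϑ D g₀ os t p g k) (fun s => by rw [hlow]; exact hint s)
    (fun s' => measurable_wTop2At F N ϑ p g k hζm θ δ' s') (fun s' U V' => abs_wTop2At_le_one F N ϑ p g k hζ1 θ δ' s' U V')
    (fun s' => measurable_chiSeqOfRecordAt_of_localBg (localBgMeasurable F N ϑ.ν) ϑ.τ9.M g p.K (k + 1) _ s')
    (isStepUnity_wTop2At F N ϑ p g k hζu θ δ')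
  rw [hlow, htop] at h
  exact h

/-- ★ **E1-STEP FOR THE PAIR-LETTERED TERMS**: for EVERY letter pair `(θ, δ′)` the pair-lettered class weights re-sum to the record's level-`k` partition sum
`Σ_{s′} topClassWeight2^{θ,δ′}(s′) = Σ_s classWeight_k(s)` (the RT identity tested against `1`). [bookkeeping] -/
theorem sum_topClassWeight2At_eq (hk : k + 1 = p.K) (hζm : ZetaMeasurable F N ϑ.ζ) (hζ1 : IsZetaAbsLeOne F N ϑ.ν ϑ.τ9.M ϑ.ζ)
    (hζu : IsZetaUnity F N ϑ.ν ϑ.τ9.M ϑ.ζ) (θ δ' t : ℝ)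
    (hint : ∀ s : SeqOfRecord F ϑ.ν ϑ.τ9.M g p.K k,
      Integrable (fun U => chiSeqOfRecord F N ϑ.ν ϑ.τ9.M g p.K k s U * dressedSlotsOfDatum₉ F N ϑ D g₀ os t p g k s U) (fieldMeasure (F.P p.K) k (SU N))) :
    ∑ s', topClassWeight2At F N ϑ D g₀ os p g k θ δ' t s' = ∑ s, classWeightOfDatum₉ F N ϑ D g₀ os p g k t s := by
  have hk' : k < p.K := by omega
  have h := isRT_topAssembled2 F N ϑ D g₀ os p g k hk hζm hζ1 hζu θ δ' t hint (fun _ => 1) measurable_const ⟨1, fun _ => by simp⟩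
  simp only [mul_one] at h
  unfold topClassWeight2At classWeightOfDatum₉
  rw [← integral_finsetSum _ fun s' _ => integrable_topPiece2 F N ϑ D g₀ os p g k hk' hζm hζ1 θ θ δ' t hint s',
    ← integral_finsetSum _ fun s _ => hint s]
  exact h

end E1

/-! ## §R2 The two runs of record on the live line: E1∕E2 at every letter pair, and the common depths `(i, j)` — rows `hsel` + (H-ζ) + signs -/

section Record2

variable {F : T4Family} {N : ℕ} [NeZero N]

/-- (R) **`0 ≤` THE TWO-COLLAR SHELL OF A TOP HISTORY OF A RUN OF RECORD** on the live-selector line, in the meaningful regime (`θlo ≤ θ ≤ θhi`, `δlo ≤ δ′ ≤ δhi`); rows `hsel`,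
(H-ζ) — the `sh_nonneg` clause. [bookkeeping] -/
theorem topGap2ShellAt_nonneg_of_liveSel (θ : Stage13HParams F N) (hP : θ.Provisos₁₃CoPH F N) (g₀ : ℕ → ℝ) (os : List (ULoop F))
    (E : B12.RunParams → ℝ) (hsel : θ.ppSel = ppSelLiveOfRecord F N θ.ν θ.τ9 E (wOfRecord₉ F N θ.toStage9Params)) (hζm : ZetaMeasurable F N θ.ζ)
    (p : B12.RunParams) (k : ℕ) (hk : k + 1 = p.K) (hg : gOfRecord₁₃ F N θ.toStage13Params p 0 = g₀ p.K) {θlo θm θhi δlo δm δhi : ℝ} (hθlo : θlo ≤ θm)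
    (hθhi : θm ≤ θhi) (hδlo : δlo ≤ δm) (hδhi : δm ≤ δhi) (t : ℝ) (s' : SeqOfRecord F θ.ν θ.τ9.M (gOfRecord₁₃ F N θ.toStage13Params p) p.K (k + 1)) :
    0 ≤ topGap2ShellAt F N θ.toStage9Params (datumOfRecord₁₃CoPH F N θ hP) g₀ os p (gOfRecord₁₃ F N θ.toStage13Params p) k θlo θm θhi δlo δm δhi t s' := by
  have hζ0 : ∀ p g k s Pl Ql RS U V', 0 ≤ θ.ζ p g k s Pl Ql RS U V' :=
    fun p g k s Pl Ql RS U V' => zetaOfRecord_nonneg F N θ.ν θ.τ9.M hP.zetaUnity hP.zetaAbs p g k s Pl Ql RS U V'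
  have hU : LocalBgMeasurable F N θ.ν := localBgMeasurable F N θ.ν
  have hD : (datumOfRecord₁₃CoPH F N θ hP).AvgMeasurable := (isPrintedAveraged_datumOfRecord₁₃CoPH F N θ hP).avgMeasurable
  exact topGap2ShellAt_nonneg F N θ.toStage9Params (datumOfRecord₁₃CoPH F N θ hP) g₀ os p _ k hk hζ0 hζm hP.zetaAbs hθlo hθhi hδlo hδhi t
    (fun s => integrable_chi_mul_dressedSlots_of_ppSelLive θ.toStage9Params E hsel hU hζm hζ0 hP.zetaAbs _ hD g₀ os hg t k s) s'

/-- (R) **THE TWO-COLLAR SHELL NEVER EXCEEDS THE PAIR-LETTERED TERM** (the doubly-gapped core is `≥ 0`; `0 ≤ ζ` is the provisos'); the `sh_le` clause. [bookkeeping] -/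
theorem topGap2ShellAt_le_topClassWeight2At_of_provisos (θ : Stage13HParams F N) (hP : θ.Provisos₁₃CoPH F N) (D : FiniteEpsData F (SU N)) (g₀ : ℕ → ℝ)
    (os : List (ULoop F)) (p : B12.RunParams) (g : ℕ → ℝ) (k : ℕ) (θlo θm θhi δlo δm δhi t : ℝ) (s' : SeqOfRecord F θ.ν θ.τ9.M g p.K (k + 1)) :
    topGap2ShellAt F N θ.toStage9Params D g₀ os p g k θlo θm θhi δlo δm δhi t s' ≤ topClassWeight2At F N θ.toStage9Params D g₀ os p g k θm δm t s' :=
  topGap2ShellAt_le_topClassWeight2At F N θ.toStage9Params D g₀ os p g k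
    (fun p g k s Pl Ql RS U V' => zetaOfRecord_nonneg F N θ.ν θ.τ9.M hP.zetaUnity hP.zetaAbs p g k s Pl Ql RS U V') θlo θm θhi δlo δm δhi t s'

/-- ★★ **E1 FOR THE PAIR-LETTERED TERMS OF RUN A OF RECORD, EVERY LETTER PAIR**: on the live-selector line, `Σ_{s′} topClassWeight2^{θ,δ′}(s′) = schemeZ (datum.scheme g₀) os (K₀+K) t` —
§R1's E1-step + dag-n19-d's E1 at every level BY NAME.  Rows: `hsel`, (H-ζ). [bookkeeping] -/
theorem sum_topClassWeight2At_runA_eq_schemeZ_of_liveSel (K₀ : ℕ) (θ : Stage13HParams F N) (hP : θ.Provisos₁₃CoPH F N) (g₀ : ℕ → ℝ) (os : List (ULoop F))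
    (E : B12.RunParams → ℝ) (hsel : θ.ppSel = ppSelLiveOfRecord F N θ.ν θ.τ9 E (wOfRecord₉ F N θ.toStage9Params)) (hζm : ZetaMeasurable F N θ.ζ)
    (K kA : ℕ) (hkA : kA + 1 = K₀ + K) (θtop δtop t : ℝ) :
    ∑ s', topClassWeight2At F N θ.toStage9Params (datumOfRecord₁₃CoPH F N θ hP) g₀ os (runA₁₃ F K₀ g₀ K) (histA₁₃ θ K₀ g₀ K) kA θtop δtop t s' =
      T4GenFunBounds.schemeZ ((datumOfRecord₁₃CoPH F N θ hP).scheme g₀) os (K₀ + K) t := by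
  have hζ0 : ∀ p g k s Pl Ql RS U V', 0 ≤ θ.ζ p g k s Pl Ql RS U V' :=
    fun p g k s Pl Ql RS U V' => zetaOfRecord_nonneg F N θ.ν θ.τ9.M hP.zetaUnity hP.zetaAbs p g k s Pl Ql RS U V'
  have hU : LocalBgMeasurable F N θ.ν := localBgMeasurable F N θ.ν
  have hD : (datumOfRecord₁₃CoPH F N θ hP).AvgMeasurable := (isPrintedAveraged_datumOfRecord₁₃CoPH F N θ hP).avgMeasurable
  have hkA' : kA + 1 = (runA₁₃ F K₀ g₀ K).K := by rw [YMDAG.UVSplit.runA₁₃_K]; exact hkA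
  rw [sum_topClassWeight2At_eq F N θ.toStage9Params (datumOfRecord₁₃CoPH F N θ hP) g₀ os (runA₁₃ F K₀ g₀ K) (histA₁₃ θ K₀ g₀ K) kA hkA' hζm
    hP.zetaAbs hP.zetaUnity θtop δtop t
    (fun s => integrable_chi_mul_dressedSlots_of_ppSelLive θ.toStage9Params E hsel hU hζm hζ0 hP.zetaAbs _ hD g₀ os (histA₁₃_zero θ K₀ g₀ K) t kA s),
    sum_classWeightOfDatum₉_datumOfRecord₁₃CoPH_eq_schemeZ_of_ppSelLive θ hP E hsel hU hζm hζ0 g₀ os (histA₁₃_zero θ K₀ g₀ K) t kA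
      (by rw [← hkA']; exact Nat.le_succ kA),
    YMDAG.UVSplit.runA₁₃_K]

/-- ★★ **E2 (run B) — the same one cutoff up**: `Σ_{s′} topClassWeight2^{θ,δ′}(s′) = schemeZ (datum.scheme g₀) os (K₀+K+1) t` for EVERY letter pair of run B of record. [bookkeeping] -/
theorem sum_topClassWeight2At_runB_eq_schemeZ_of_liveSel (K₀ : ℕ) (θ : Stage13HParams F N) (hP : θ.Provisos₁₃CoPH F N) (g₀ : ℕ → ℝ) (os : List (ULoop F))
    (E : B12.RunParams → ℝ) (hsel : θ.ppSel = ppSelLiveOfRecord F N θ.ν θ.τ9 E (wOfRecord₉ F N θ.toStage9Params)) (hζm : ZetaMeasurable F N θ.ζ)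
    (K kB : ℕ) (hkB : kB + 1 = K₀ + K + 1) (θtop δtop t : ℝ) :
    ∑ s', topClassWeight2At F N θ.toStage9Params (datumOfRecord₁₃CoPH F N θ hP) g₀ os (runB₁₃ F K₀ g₀ K) (histB₁₃ θ K₀ g₀ K) kB θtop δtop t s' =
      T4GenFunBounds.schemeZ ((datumOfRecord₁₃CoPH F N θ hP).scheme g₀) os (K₀ + K + 1) t := by
  have hζ0 : ∀ p g k s Pl Ql RS U V', 0 ≤ θ.ζ p g k s Pl Ql RS U V' :=
    fun p g k s Pl Ql RS U V' => zetaOfRecord_nonneg F N θ.ν θ.τ9.M hP.zetaUnity hP.zetaAbs p g k s Pl Ql RS U V'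
  have hU : LocalBgMeasurable F N θ.ν := localBgMeasurable F N θ.ν
  have hD : (datumOfRecord₁₃CoPH F N θ hP).AvgMeasurable := (isPrintedAveraged_datumOfRecord₁₃CoPH F N θ hP).avgMeasurable
  have hkB' : kB + 1 = (runB₁₃ F K₀ g₀ K).K := by rw [YMDAG.UVSplit.runB₁₃_K]; exact hkB
  rw [sum_topClassWeight2At_eq F N θ.toStage9Params (datumOfRecord₁₃CoPH F N θ hP) g₀ os (runB₁₃ F K₀ g₀ K) (histB₁₃ θ K₀ g₀ K) kB hkB' hζm
    hP.zetaAbs hP.zetaUnity θtop δtop t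
    (fun s => integrable_chi_mul_dressedSlots_of_ppSelLive θ.toStage9Params E hsel hU hζm hζ0 hP.zetaAbs _ hD g₀ os (histB₁₃_zero θ K₀ g₀ K) t kB s),
    sum_classWeightOfDatum₉_datumOfRecord₁₃CoPH_eq_schemeZ_of_ppSelLive θ hP E hsel hU hζm hζ0 g₀ os (histB₁₃_zero θ K₀ g₀ K) t kB
      (by rw [← hkB']; exact Nat.le_succ kB),
    YMDAG.UVSplit.runB₁₃_K]

/-- ★★★ **(M1)-FREE NE7c, BOTH COLLARS OF BOTH FAMILIES, AT THE PAIR-LETTERED TERMS OF THE TWO RUNS OF RECORD: ONE COMMON (3.2) DEPTH AND ONE COMMON (3.3) DEPTH** — §Q5 at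
`runA₁₃ ∕ runB₁₃`.  Rows: the live-selector pin `hsel`, (H-ζ) `hζm`, the dial rows `0 ≤ ρ, ρ′ ≤ 1`, both tops' `0 ≤ ε` and `0 ≤ δ`, the positivity of both tops; everything else
(`0 ≤ ζ`, `Σ|ζ| ≤ 1`, `Σζ = 1`, (H-U), (e1)) is the provisos' ∕ the tree's.  NO anti-concentration, NO estimate of Bałaban's. [bookkeeping] -/
theorem exists_common_depths_topGap2Shell_le_of_liveSel (K₀ : ℕ) (θ : Stage13HParams F N) (hP : θ.Provisos₁₃CoPH F N) (g₀ : ℕ → ℝ) (os : List (ULoop F))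
    (E : B12.RunParams → ℝ) (hsel : θ.ppSel = ppSelLiveOfRecord F N θ.ν θ.τ9 E (wOfRecord₉ F N θ.toStage9Params)) (hζm : ZetaMeasurable F N θ.ζ)
    (K kA kB : ℕ) (hkA : kA + 1 = K₀ + K) (hkB : kB + 1 = K₀ + K + 1) {ρ ρ' : ℝ} (hρ0 : 0 ≤ ρ) (hρ1 : ρ ≤ 1) (hρ'0 : 0 ≤ ρ') (hρ'1 : ρ' ≤ 1)
    (hεA : 0 ≤ epsOfRecord θ.ν (histA₁₃ θ K₀ g₀ K) (kA + 1)) (hεB : 0 ≤ epsOfRecord θ.ν (histB₁₃ θ K₀ g₀ K) (kB + 1))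
    (hδA : 0 ≤ deltaOfRecord θ.ν (histA₁₃ θ K₀ g₀ K) kA θ.A₁) (hδB : 0 ≤ deltaOfRecord θ.ν (histB₁₃ θ K₀ g₀ K) kB θ.A₁) (n₁ n₂ : ℕ) (t : ℝ) :
    ∃ i ∈ Finset.range (n₁ + 1), ∃ j ∈ Finset.range (n₂ + 1),
      ∑ s', topGap2ShellAt F N θ.toStage9Params (datumOfRecord₁₃CoPH F N θ hP) g₀ os (runA₁₃ F K₀ g₀ K) (histA₁₃ θ K₀ g₀ K) kA
            (cutGrid θ.ν (histA₁₃ θ K₀ g₀ K) (kA + 1) ρ (i + 2)) (cutGrid θ.ν (histA₁₃ θ K₀ g₀ K) (kA + 1) ρ (i + 1)) (cutGrid θ.ν (histA₁₃ θ K₀ g₀ K) (kA + 1) ρ i)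
            (bCutGrid θ.ν θ.A₁ (histA₁₃ θ K₀ g₀ K) kA ρ' (j + 2)) (bCutGrid θ.ν θ.A₁ (histA₁₃ θ K₀ g₀ K) kA ρ' (j + 1)) (bCutGrid θ.ν θ.A₁ (histA₁₃ θ K₀ g₀ K) kA ρ' j)
            t s' ≤
          4 * (2 * (F.L : ℝ) ^ F.m) ^ 4 * (1 / (n₁ + 1 : ℕ) + 1 / (n₂ + 1 : ℕ)) *
            ∑ s, classWeightOfDatum₉ F N θ.toStage9Params (datumOfRecord₁₃CoPH F N θ hP) g₀ os (runA₁₃ F K₀ g₀ K) (histA₁₃ θ K₀ g₀ K) kA t s ∧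
        ∑ s', topGap2ShellAt F N θ.toStage9Params (datumOfRecord₁₃CoPH F N θ hP) g₀ os (runB₁₃ F K₀ g₀ K) (histB₁₃ θ K₀ g₀ K) kB
            (cutGrid θ.ν (histB₁₃ θ K₀ g₀ K) (kB + 1) ρ (i + 2)) (cutGrid θ.ν (histB₁₃ θ K₀ g₀ K) (kB + 1) ρ (i + 1)) (cutGrid θ.ν (histB₁₃ θ K₀ g₀ K) (kB + 1) ρ i)
            (bCutGrid θ.ν θ.A₁ (histB₁₃ θ K₀ g₀ K) kB ρ' (j + 2)) (bCutGrid θ.ν θ.A₁ (histB₁₃ θ K₀ g₀ K) kB ρ' (j + 1)) (bCutGrid θ.ν θ.A₁ (histB₁₃ θ K₀ g₀ K) kB ρ' j)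
            t s' ≤
          4 * (2 * (F.L : ℝ) ^ F.m) ^ 4 * (1 / (n₁ + 1 : ℕ) + 1 / (n₂ + 1 : ℕ)) *
            ∑ s, classWeightOfDatum₉ F N θ.toStage9Params (datumOfRecord₁₃CoPH F N θ hP) g₀ os (runB₁₃ F K₀ g₀ K) (histB₁₃ θ K₀ g₀ K) kB t s := by
  have hζ0 : ∀ p g k s Pl Ql RS U V', 0 ≤ θ.ζ p g k s Pl Ql RS U V' :=
    fun p g k s Pl Ql RS U V' => zetaOfRecord_nonneg F N θ.ν θ.τ9.M hP.zetaUnity hP.zetaAbs p g k s Pl Ql RS U V'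
  have hU : LocalBgMeasurable F N θ.ν := localBgMeasurable F N θ.ν
  have hD : (datumOfRecord₁₃CoPH F N θ hP).AvgMeasurable := (isPrintedAveraged_datumOfRecord₁₃CoPH F N θ hP).avgMeasurable
  have hkA' : kA + 1 = (runA₁₃ F K₀ g₀ K).K := by rw [YMDAG.UVSplit.runA₁₃_K]; exact hkA
  have hkB' : kB + 1 = (runB₁₃ F K₀ g₀ K).K := by rw [YMDAG.UVSplit.runB₁₃_K]; exact hkB
  exact exists_common_depths_topGap2Shell_le F N θ.toStage9Params (datumOfRecord₁₃CoPH F N θ hP) g₀ os (runA₁₃ F K₀ g₀ K) (histA₁₃ θ K₀ g₀ K) kA hkA'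
    (runB₁₃ F K₀ g₀ K) (histB₁₃ θ K₀ g₀ K) kB hkB' hζ0 hζm hP.zetaAbs hP.zetaUnity hεA hεB hδA hδB hρ0 hρ1 hρ'0 hρ'1 n₁ n₂ t
    (fun s => integrable_chi_mul_dressedSlots_of_ppSelLive θ.toStage9Params E hsel hU hζm hζ0 hP.zetaAbs _ hD g₀ os (histA₁₃_zero θ K₀ g₀ K) t kA s)
    (fun s => integrable_chi_mul_dressedSlots_of_ppSelLive θ.toStage9Params E hsel hU hζm hζ0 hP.zetaAbs _ hD g₀ os (histB₁₃_zero θ K₀ g₀ K) t kB s)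

/-- ★★★ **NE7c's OUTPUT INEQUALITIES, BOTH COLLARS OF BOTH FAMILIES, FOR THE PAIR-LETTERED TERMS OF RECORD AT THE SELECTED COMMON DEPTHS, IN THE SHAPE `Σ sh ≤ Wsh · Σ A`**: on
the live-selector line SOME common `i ≤ n₁` and SOME common `j ≤ n₂` have, for BOTH runs of record,
`Σ_{s′} shell2(θ_{i+2},θ_{i+1},θ_i; δ′_{j+2},δ′_{j+1},δ′_j)(s′) ≤ 4(2L^m)⁴(1∕(n₁+1) + 1∕(n₂+1)) · Σ_{s′} topClassWeight2^{θ_{i+1},δ′_{j+1}}(s′)` — the shells RELATIVE TO THE PAIR-LETTERED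
TERMS THEMSELVES at the selected middle letters (both sums are the run's partition function, E1∕E2).  With `Σ_K (1∕(n₁,K+1) + 1∕(n₂,K+1)) < ∞` these are the `left ∕ right` fields of
`T4IndicatorShell.ShellWeightBound` for a reading with two-collar shells of both families; rows `hsel` + (H-ζ) + signs; (M1)-FREE. [bookkeeping] -/
theorem exists_common_depths_topGap2Shell_le_topClassWeight2_of_liveSel (K₀ : ℕ) (θ : Stage13HParams F N) (hP : θ.Provisos₁₃CoPH F N) (g₀ : ℕ → ℝ)
    (os : List (ULoop F)) (E : B12.RunParams → ℝ) (hsel : θ.ppSel = ppSelLiveOfRecord F N θ.ν θ.τ9 E (wOfRecord₉ F N θ.toStage9Params)) (hζm : ZetaMeasurable F N θ.ζ)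
    (K kA kB : ℕ) (hkA : kA + 1 = K₀ + K) (hkB : kB + 1 = K₀ + K + 1) {ρ ρ' : ℝ} (hρ0 : 0 ≤ ρ) (hρ1 : ρ ≤ 1) (hρ'0 : 0 ≤ ρ') (hρ'1 : ρ' ≤ 1)
    (hεA : 0 ≤ epsOfRecord θ.ν (histA₁₃ θ K₀ g₀ K) (kA + 1)) (hεB : 0 ≤ epsOfRecord θ.ν (histB₁₃ θ K₀ g₀ K) (kB + 1))
    (hδA : 0 ≤ deltaOfRecord θ.ν (histA₁₃ θ K₀ g₀ K) kA θ.A₁) (hδB : 0 ≤ deltaOfRecord θ.ν (histB₁₃ θ K₀ g₀ K) kB θ.A₁) (n₁ n₂ : ℕ) (t : ℝ) :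
    ∃ i ∈ Finset.range (n₁ + 1), ∃ j ∈ Finset.range (n₂ + 1),
      ∑ s', topGap2ShellAt F N θ.toStage9Params (datumOfRecord₁₃CoPH F N θ hP) g₀ os (runA₁₃ F K₀ g₀ K) (histA₁₃ θ K₀ g₀ K) kA
            (cutGrid θ.ν (histA₁₃ θ K₀ g₀ K) (kA + 1) ρ (i + 2)) (cutGrid θ.ν (histA₁₃ θ K₀ g₀ K) (kA + 1) ρ (i + 1)) (cutGrid θ.ν (histA₁₃ θ K₀ g₀ K) (kA + 1) ρ i)
            (bCutGrid θ.ν θ.A₁ (histA₁₃ θ K₀ g₀ K) kA ρ' (j + 2)) (bCutGrid θ.ν θ.A₁ (histA₁₃ θ K₀ g₀ K) kA ρ' (j + 1)) (bCutGrid θ.ν θ.A₁ (histA₁₃ θ K₀ g₀ K) kA ρ' j)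
            t s' ≤
          4 * (2 * (F.L : ℝ) ^ F.m) ^ 4 * (1 / (n₁ + 1 : ℕ) + 1 / (n₂ + 1 : ℕ)) *
            ∑ s', topClassWeight2At F N θ.toStage9Params (datumOfRecord₁₃CoPH F N θ hP) g₀ os (runA₁₃ F K₀ g₀ K) (histA₁₃ θ K₀ g₀ K) kA
              (cutGrid θ.ν (histA₁₃ θ K₀ g₀ K) (kA + 1) ρ (i + 1)) (bCutGrid θ.ν θ.A₁ (histA₁₃ θ K₀ g₀ K) kA ρ' (j + 1)) t s' ∧
        ∑ s', topGap2ShellAt F N θ.toStage9Params (datumOfRecord₁₃CoPH F N θ hP) g₀ os (runB₁₃ F K₀ g₀ K) (histB₁₃ θ K₀ g₀ K) kB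
            (cutGrid θ.ν (histB₁₃ θ K₀ g₀ K) (kB + 1) ρ (i + 2)) (cutGrid θ.ν (histB₁₃ θ K₀ g₀ K) (kB + 1) ρ (i + 1)) (cutGrid θ.ν (histB₁₃ θ K₀ g₀ K) (kB + 1) ρ i)
            (bCutGrid θ.ν θ.A₁ (histB₁₃ θ K₀ g₀ K) kB ρ' (j + 2)) (bCutGrid θ.ν θ.A₁ (histB₁₃ θ K₀ g₀ K) kB ρ' (j + 1)) (bCutGrid θ.ν θ.A₁ (histB₁₃ θ K₀ g₀ K) kB ρ' j)
            t s' ≤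
          4 * (2 * (F.L : ℝ) ^ F.m) ^ 4 * (1 / (n₁ + 1 : ℕ) + 1 / (n₂ + 1 : ℕ)) *
            ∑ s', topClassWeight2At F N θ.toStage9Params (datumOfRecord₁₃CoPH F N θ hP) g₀ os (runB₁₃ F K₀ g₀ K) (histB₁₃ θ K₀ g₀ K) kB
              (cutGrid θ.ν (histB₁₃ θ K₀ g₀ K) (kB + 1) ρ (i + 1)) (bCutGrid θ.ν θ.A₁ (histB₁₃ θ K₀ g₀ K) kB ρ' (j + 1)) t s' := by
  have hζ0 : ∀ p g k s Pl Ql RS U V', 0 ≤ θ.ζ p g k s Pl Ql RS U V' :=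
    fun p g k s Pl Ql RS U V' => zetaOfRecord_nonneg F N θ.ν θ.τ9.M hP.zetaUnity hP.zetaAbs p g k s Pl Ql RS U V'
  have hU : LocalBgMeasurable F N θ.ν := localBgMeasurable F N θ.ν
  have hkA' : kA + 1 = (runA₁₃ F K₀ g₀ K).K := by rw [YMDAG.UVSplit.runA₁₃_K]; exact hkA
  have hkB' : kB + 1 = (runB₁₃ F K₀ g₀ K).K := by rw [YMDAG.UVSplit.runB₁₃_K]; exact hkB
  have hEA := sum_classWeightOfDatum₉_datumOfRecord₁₃CoPH_eq_schemeZ_of_ppSelLive θ hP E hsel hU hζm hζ0 g₀ os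
    (histA₁₃_zero θ K₀ g₀ K) t kA (by rw [← hkA']; exact Nat.le_succ kA)
  have hEB := sum_classWeightOfDatum₉_datumOfRecord₁₃CoPH_eq_schemeZ_of_ppSelLive θ hP E hsel hU hζm hζ0 g₀ os
    (histB₁₃_zero θ K₀ g₀ K) t kB (by rw [← hkB']; exact Nat.le_succ kB)
  obtain ⟨i, hi, j, hj, hA, hB⟩ := exists_common_depths_topGap2Shell_le_of_liveSel K₀ θ hP g₀ os E hsel hζm K kA kB hkA hkB hρ0 hρ1 hρ'0 hρ'1 hεA hεB hδA hδB n₁ n₂ t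
  have eA : ∑ s, classWeightOfDatum₉ F N θ.toStage9Params (datumOfRecord₁₃CoPH F N θ hP) g₀ os (runA₁₃ F K₀ g₀ K) (histA₁₃ θ K₀ g₀ K) kA t s =
      ∑ s', topClassWeight2At F N θ.toStage9Params (datumOfRecord₁₃CoPH F N θ hP) g₀ os (runA₁₃ F K₀ g₀ K) (histA₁₃ θ K₀ g₀ K) kA
        (cutGrid θ.ν (histA₁₃ θ K₀ g₀ K) (kA + 1) ρ (i + 1)) (bCutGrid θ.ν θ.A₁ (histA₁₃ θ K₀ g₀ K) kA ρ' (j + 1)) t s' :=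
    hEA.trans (sum_topClassWeight2At_runA_eq_schemeZ_of_liveSel K₀ θ hP g₀ os E hsel hζm K kA hkA _ _ t).symm
  have eB : ∑ s, classWeightOfDatum₉ F N θ.toStage9Params (datumOfRecord₁₃CoPH F N θ hP) g₀ os (runB₁₃ F K₀ g₀ K) (histB₁₃ θ K₀ g₀ K) kB t s =
      ∑ s', topClassWeight2At F N θ.toStage9Params (datumOfRecord₁₃CoPH F N θ hP) g₀ os (runB₁₃ F K₀ g₀ K) (histB₁₃ θ K₀ g₀ K) kB
        (cutGrid θ.ν (histB₁₃ θ K₀ g₀ K) (kB + 1) ρ (i + 1)) (bCutGrid θ.ν θ.A₁ (histB₁₃ θ K₀ g₀ K) kB ρ' (j + 1)) t s' :=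
    hEB.trans (sum_topClassWeight2At_runB_eq_schemeZ_of_liveSel K₀ θ hP g₀ os E hsel hζm K kB hkB _ _ t).symm
  refine ⟨i, hi, j, hj, ?_, ?_⟩
  · rw [← eA]; exact hA
  · rw [← eB]; exact hB

end Record2

end Summit.QuantumFields.YangMills.Theorems.N21GappedTopPair13CoPH

end
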